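import Literature.NumberTheory.LFunctions.Bettin2017OffDiagonalSplit
import HarnessLib

/-!
# The off-diagonal of Bettin 2017, Thm. 1.1 at prime level is `≪ m^{1/2} N^{-1+ε}` for `m ≤ N^B`
# (stub S4 `stub_offDiagonal` of the I2 skeleton `hecke_afe_petersson`)

Topic `Literature/NumberTheory/LFunctions` (cell landau-siegel / ls-inputs, input I2 =
`bettin2017_theorem11_primeLevel`).

With the weight `w(n) = n^{-1/2} e^{-2πn/(mN²)}` (the exact two-sided central-value formula at the
unbalanced height `y = 1/(mN²)`) and Kowalski–Michel's `J(m,n) = petJ N m n`, for every `B` and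
`ε > 0` there are `C, N₀` with

  `‖Σ_n w(n) J(m,n)‖ ≤ C m^{1/2} N^{-1+ε}`   (`N ≥ N₀` prime, `1 ≤ m ≤ N^B`).

Proof: `norm_tsum_weight_mul_petJ_le` (the opened-Kloosterman / partial-summation bound, Bettin §2
(2.5) + §4 (4.3) at `q = 1`, `α = 0`, and Weil's bound for the tail) with `R + 1 = m^{16} N^{28}`:
the tail is then exactly `(8CZ/π)√m`, the head is `≤ 2π(2B+9)(16B+30)²(1 + log N)³ √m` (all the
logarithms — `Λ(y) ≤ log(1 + mN²)`, `log(N(R+1))`, `Σ_{r≤R} 1/r ≤ 1 + log(R+1)` — are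
`≪_B 1 + log N` because `m ≤ N^B`: this is Bettin's «we assume m ≪ N^{100}», p. 5), and
`(1 + log N)³ ≤ (1 + 3/ε)³ N^ε`. Everything is proved; no definition, no named fact.
-/

noncomputable section

open scoped Real
open Complex Finset Filter Topology
open Literature.NumberTheory.LFunctions.KowalskiMichel2000

namespace Literature.NumberTheory.LFunctions.Bettin2017

/-! ### Logarithmic bookkeeping -/

/-- `Σ_{r ≤ R} 1/r ≤ 1 + log(R + 1)` (with the convention `1/0 = 0`; harmonic bound).
[cite: Apostol1976, Thm. 3.2 (a)] -/
theorem sum_range_succ_inv_le (R : ℕ) :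
    ∑ r ∈ range (R + 1), (r : ℝ)⁻¹ ≤ 1 + Real.log ((R : ℝ) + 1) := by
  rw [Finset.sum_range_succ']
  simp only [Nat.cast_zero, inv_zero, add_zero]
  have h1 : (harmonic R : ℝ) = ∑ i ∈ range R, ((i + 1 : ℕ) : ℝ)⁻¹ := by
    simp [harmonic]
  rw [← h1]
  refine (harmonic_le_one_add_log R).trans ?_
  have : Real.log (R : ℝ) ≤ Real.log ((R : ℝ) + 1) := by
    rcases Nat.eq_zero_or_pos R with rfl | hR
    · simp
    · exact Real.log_le_log (by exact_mod_cast hR) (by linarith)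
  linarith

/-- `−log(1 − e^{−t}) ≤ log(1 + t⁻¹)` for `t > 0` (`(1 + t) e^{−t} ≤ 1`). [folklore] -/
private theorem neg_log_one_sub_exp_le {t : ℝ} (ht : 0 < t) :
    -Real.log (1 - Real.exp (-t)) ≤ Real.log (1 + t⁻¹) := by
  have he0 : 0 < Real.exp (-t) := Real.exp_pos _
  have he1 : Real.exp (-t) < 1 := by
    rw [← Real.exp_zero]; exact Real.exp_lt_exp.mpr (by linarith)
  have ha : 0 < 1 - Real.exp (-t) := by linarith
  rw [← Real.log_inv]
  apply Real.log_le_log (inv_pos.mpr ha)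
  rw [inv_le_iff_one_le_mul₀ ha]
  have h := Real.add_one_le_exp t
  have hprod : Real.exp (-t) * Real.exp t = 1 := by rw [← Real.exp_add]; simp
  have hx : Real.exp (-t) * (1 + t) ≤ 1 := by nlinarith
  have heq : (1 + t⁻¹) * (1 - Real.exp (-t)) = 1 + (1 - Real.exp (-t) * (1 + t)) * t⁻¹ := by
    field_simp; ring
  rw [heq]
  have : 0 ≤ (1 - Real.exp (-t) * (1 + t)) * t⁻¹ := mul_nonneg (by linarith) (inv_pos.mpr ht).le
  linarith

/-- `(1 + log x)^3 ≤ (1 + 3/ε)^3 x^ε` for `x ≥ 1`, `ε > 0` (`log x ≤ x^s/s`). [folklore] -/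
private theorem one_add_log_pow_three_le {x ε : ℝ} (hx : 1 ≤ x) (hε : 0 < ε) :
    (1 + Real.log x) ^ 3 ≤ (1 + 3 / ε) ^ 3 * x ^ ε := by
  have hx0 : 0 < x := by linarith
  have hlog0 : 0 ≤ Real.log x := Real.log_nonneg hx
  have hs : 0 < ε / 3 := by positivity
  have h1 : Real.log x ≤ 3 / ε * x ^ (ε / 3) := by
    calc Real.log x ≤ x ^ (ε / 3) / (ε / 3) := Real.log_le_rpow_div hx0.le hs
      _ = 3 / ε * x ^ (ε / 3) := by rw [div_div_eq_mul_div]; ring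
  have h2 : (1 : ℝ) ≤ x ^ (ε / 3) := Real.one_le_rpow hx hs.le
  have h3 : 1 + Real.log x ≤ (1 + 3 / ε) * x ^ (ε / 3) := by
    have : (1 + 3 / ε) * x ^ (ε / 3) = x ^ (ε / 3) + 3 / ε * x ^ (ε / 3) := by ring
    rw [this]; linarith
  have h4 : (1 + Real.log x) ^ 3 ≤ ((1 + 3 / ε) * x ^ (ε / 3)) ^ 3 :=
    pow_le_pow_left₀ (by linarith) h3 3
  have h5 : ((1 + 3 / ε) * x ^ (ε / 3)) ^ 3 = (1 + 3 / ε) ^ 3 * x ^ ε := by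
    rw [mul_pow, ← Real.rpow_natCast (x ^ (ε / 3)) 3, ← Real.rpow_mul hx0.le]
    norm_num
  rw [h5] at h4
  exact h4

/-! ### The off-diagonal bound -/

set_option maxHeartbeats 400000 in
/-- **The off-diagonal of Bettin 2017, Thm. 1.1 at prime level (stub S4 of the I2 skeleton).** For
every `B` and `ε > 0` there are `C, N₀` such that for all primes `N ≥ N₀` and `1 ≤ m ≤ N^B`,
`‖Σ_n n^{-1/2} e^{-2πn/(mN²)} J_N(m,n)‖ ≤ C m^{1/2} N^{-1+ε}` (`J_N = KowalskiMichel2000.petJ N`).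
Bettin §2 (2.3)–(2.5) + §4 at `q = 1`, `α = 0`, with partial summation in place of the
periodic-zeta functional equation, and «m ≪ N^{100}» (p. 5) to absorb the logarithms.
[cite: Bettin2017, §2 (2.3)–(2.5), §3, §4] -/
theorem offDiagonal_le :
    ∀ B : ℕ, ∀ ε : ℝ, 0 < ε → ∃ C : ℝ, ∃ N₀ : ℕ, ∀ (N : ℕ) [NeZero N], N.Prime → N₀ ≤ N →
      ∀ m : ℕ, 1 ≤ m → (m : ℝ) ≤ (N : ℝ) ^ B →
        ‖∑' n : ℕ, (((n : ℝ) ^ (-(1 / 2 : ℝ)) *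
              Real.exp (-(2 * Real.pi * n) * (1 / ((m : ℝ) * (N : ℝ) ^ 2))) : ℝ) : ℂ) *
            KowalskiMichel2000.petJ N m n‖ ≤
          C * (m : ℝ) ^ (1 / 2 : ℝ) * (N : ℝ) ^ (-1 + ε) := by
  intro B ε hε
  obtain ⟨C, hC1, hC⟩ :=
    Literature.NumberTheory.Sieve.exists_card_divisors_le_mul_rpow' (by norm_num : (0 : ℝ) < 1 / 4)
  have hC0 : 0 ≤ C := by linarith
  have hB0 : (0 : ℝ) ≤ B := Nat.cast_nonneg B
  -- the absolute constants
  obtain ⟨Z, hZ⟩ : ∃ Z : ℝ, Z = ∑' r : ℕ, (((r + 1 : ℕ) : ℝ)) ^ (-(9 / 8 : ℝ)) := ⟨_, rfl⟩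
  have hZ0 : 0 ≤ Z := by rw [hZ]; exact tsum_nonneg fun r ↦ Real.rpow_nonneg (Nat.cast_nonneg _) _
  obtain ⟨A, hA⟩ : ∃ A : ℝ, A = 2 * π * (2 * B + 9) * (16 * B + 30) ^ 2 := ⟨_, rfl⟩
  obtain ⟨a, ha⟩ : ∃ a : ℝ, a = 8 * C * Z / π := ⟨_, rfl⟩
  have hA0 : 0 ≤ A := by rw [hA]; positivity
  have ha0 : 0 ≤ a := by rw [ha]; positivity
  obtain ⟨K₀, hK₀⟩ : ∃ K₀ : ℝ, K₀ = A + a := ⟨_, rfl⟩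
  have hK₀0 : 0 ≤ K₀ := by rw [hK₀]; positivity
  refine ⟨2 * π * K₀ * (1 + 3 / ε) ^ 3, 2, fun N _ hN hN₀ m hm hmB ↦ ?_⟩
  -- sizes
  have hN2 : (2 : ℝ) ≤ N := by exact_mod_cast hN₀
  have hN0 : (0 : ℝ) < N := by linarith
  have hN1 : (1 : ℝ) ≤ N := by linarith
  have hm0 : (0 : ℝ) < m := by exact_mod_cast hm
  have hm1 : (1 : ℝ) ≤ m := by exact_mod_cast hm
  have hmN : (4 : ℝ) ≤ (m : ℝ) * (N : ℝ) ^ 2 := by nlinarith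
  obtain ⟨L, hL⟩ : ∃ L : ℝ, L = Real.log N := ⟨_, rfl⟩
  have hL0 : 0 ≤ L := by rw [hL]; exact Real.log_nonneg hN1
  have hlogm : Real.log m ≤ B * L := by
    calc Real.log m ≤ Real.log ((N : ℝ) ^ B) := Real.log_le_log hm0 hmB
      _ = B * L := by rw [Real.log_pow, hL]
  -- the height and the cut
  obtain ⟨y, hy_def⟩ : ∃ y : ℝ, y = 1 / ((m : ℝ) * (N : ℝ) ^ 2) := ⟨_, rfl⟩
  have hy : 0 < y := by rw [hy_def]; positivity
  have hmN1 : 1 ≤ m ^ 16 * N ^ 28 := Nat.one_le_iff_ne_zero.mpr (by positivity)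
  obtain ⟨R, hR⟩ : ∃ R : ℕ, R = m ^ 16 * N ^ 28 - 1 := ⟨_, rfl⟩
  have hR1 : R + 1 = m ^ 16 * N ^ 28 := by rw [hR]; omega
  have hR1r : ((R + 1 : ℕ) : ℝ) = (m : ℝ) ^ 16 * (N : ℝ) ^ 28 := by rw [hR1]; push_cast; ring
  have hR1r' : (R : ℝ) + 1 = (m : ℝ) ^ 16 * (N : ℝ) ^ 28 := by exact_mod_cast hR1r
  rw [← hy_def]
  -- (1) logarithms are `≪ 1 + L`
  have hm16 : (1 : ℝ) ≤ (m : ℝ) ^ 16 := one_le_pow₀ hm1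
  have hN28 : (1 : ℝ) ≤ (N : ℝ) ^ 28 := one_le_pow₀ hN1
  have hlog1 : Real.log ((N : ℝ) * (R + 1)) ≤ (16 * B + 29) * L := by
    rw [hR1r', show (N : ℝ) * ((m : ℝ) ^ 16 * (N : ℝ) ^ 28) = (m : ℝ) ^ 16 * (N : ℝ) ^ 29 by ring,
      Real.log_mul (by positivity) (by positivity), Real.log_pow, Real.log_pow, ← hL]
    push_cast
    have := mul_le_mul_of_nonneg_left hlogm (by norm_num : (0 : ℝ) ≤ 16)
    linarith
  have hlog1' : 0 ≤ Real.log ((N : ℝ) * (R + 1)) := by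
    apply Real.log_nonneg; rw [hR1r']; nlinarith
  have hlog2 : Real.log ((R : ℝ) + 1) ≤ (16 * B + 29) * L := by
    rw [hR1r', Real.log_mul (by positivity) (by positivity), Real.log_pow, Real.log_pow, ← hL]
    push_cast
    have := mul_le_mul_of_nonneg_left hlogm (by norm_num : (0 : ℝ) ≤ 16)
    linarith
  have hΛ : -Real.log (1 - Real.exp (-(2 * π * y))) ≤ 1 + (B + 2) * L := by
    have h1 := neg_log_one_sub_exp_le (t := 2 * π * y) (by positivity)
    refine h1.trans ?_
    have hinv : (2 * π * y)⁻¹ = (m : ℝ) * (N : ℝ) ^ 2 / (2 * π) := by rw [hy_def]; field_simp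
    have h2 : 1 + (2 * π * y)⁻¹ ≤ 2 * ((m : ℝ) * (N : ℝ) ^ 2) := by
      rw [hinv]
      have hπ : (1 : ℝ) ≤ 2 * π := by linarith [Real.pi_gt_three]
      have : (m : ℝ) * (N : ℝ) ^ 2 / (2 * π) ≤ (m : ℝ) * (N : ℝ) ^ 2 :=
        div_le_self (by positivity) hπ
      linarith
    calc Real.log (1 + (2 * π * y)⁻¹) ≤ Real.log (2 * ((m : ℝ) * (N : ℝ) ^ 2)) :=
          Real.log_le_log (by positivity) h2
      _ = Real.log 2 + Real.log m + 2 * L := by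
          rw [Real.log_mul (by norm_num) (by positivity),
            Real.log_mul (by positivity) (by positivity), Real.log_pow, hL]
          push_cast; ring
      _ ≤ 1 + (B + 2) * L := by
          have hl2 : Real.log 2 ≤ 1 := by
            have := Real.log_two_lt_d9; norm_num at this; linarith
          linarith
  have hΛ0 : 0 ≤ -Real.log (1 - Real.exp (-(2 * π * y))) := by
    have he0 : 0 < Real.exp (-(2 * π * y)) := Real.exp_pos _
    have he1 : Real.exp (-(2 * π * y)) < 1 := by
      rw [← Real.exp_zero]; exact Real.exp_lt_exp.mpr (by nlinarith [Real.pi_pos])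
    rw [neg_nonneg]; exact Real.log_nonpos (by linarith) (by linarith)
  -- (2) the head
  have hH := sum_range_succ_inv_le R
  have hH0 : 0 ≤ ∑ r ∈ range (R + 1), (r : ℝ)⁻¹ :=
    Finset.sum_nonneg fun r _ ↦ inv_nonneg.mpr (Nat.cast_nonneg r)
  have e1 : 3 + 2 * (-Real.log (1 - Real.exp (-(2 * π * y)))) ≤ (2 * B + 9) * (1 + L) := by
    have := mul_nonneg hB0 hL0
    linarith
  have e2 : 1 + Real.log ((N : ℝ) * (R + 1)) ≤ (16 * B + 30) * (1 + L) := by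
    have := mul_nonneg hB0 hL0
    linarith
  have e3 : ∑ r ∈ range (R + 1), (r : ℝ)⁻¹ ≤ (16 * B + 30) * (1 + L) := by
    have := mul_nonneg hB0 hL0
    linarith
  have hhead : 2 * π * (3 + 2 * (-Real.log (1 - Real.exp (-(2 * π * y))))) *
        (1 + Real.log ((N : ℝ) * (R + 1))) * Real.sqrt m * (∑ r ∈ range (R + 1), (r : ℝ)⁻¹) ≤
      2 * π * (2 * B + 9) * (16 * B + 30) ^ 2 * (1 + L) ^ 3 * Real.sqrt m := by
    have hprod : (3 + 2 * (-Real.log (1 - Real.exp (-(2 * π * y))))) *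
        (1 + Real.log ((N : ℝ) * (R + 1))) * (∑ r ∈ range (R + 1), (r : ℝ)⁻¹) ≤
        ((2 * B + 9) * (1 + L)) * ((16 * B + 30) * (1 + L)) * ((16 * B + 30) * (1 + L)) :=
      mul_le_mul (mul_le_mul e1 e2 (by linarith) (by positivity)) e3 hH0 (by positivity)
    calc 2 * π * (3 + 2 * (-Real.log (1 - Real.exp (-(2 * π * y))))) *
          (1 + Real.log ((N : ℝ) * (R + 1))) * Real.sqrt m * (∑ r ∈ range (R + 1), (r : ℝ)⁻¹)
        = 2 * π * Real.sqrt m * ((3 + 2 * (-Real.log (1 - Real.exp (-(2 * π * y))))) *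
            (1 + Real.log ((N : ℝ) * (R + 1))) * (∑ r ∈ range (R + 1), (r : ℝ)⁻¹)) := by ring
      _ ≤ 2 * π * Real.sqrt m *
            (((2 * B + 9) * (1 + L)) * ((16 * B + 30) * (1 + L)) * ((16 * B + 30) * (1 + L))) :=
          mul_le_mul_of_nonneg_left hprod (by positivity)
      _ = 2 * π * (2 * B + 9) * (16 * B + 30) ^ 2 * (1 + L) ^ 3 * Real.sqrt m := by ring
  -- (4) assemble
  rw [← hA] at hhead
  obtain ⟨P, hP⟩ : ∃ P : ℝ, P = (1 + L) ^ 3 := ⟨_, rfl⟩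
  rw [← hP] at hhead
  have hP1 : 1 ≤ P := by rw [hP]; exact one_le_pow₀ (by linarith)
  have hsqrt0 : 0 ≤ Real.sqrt m := Real.sqrt_nonneg _
  have hsum : A * P * Real.sqrt m + a * Real.sqrt m ≤ K₀ * P * Real.sqrt m := by
    rw [hK₀]
    have h0 : 0 ≤ a * Real.sqrt m * (P - 1) :=
      mul_nonneg (mul_nonneg ha0 hsqrt0) (sub_nonneg.mpr hP1)
    have e : (A + a) * P * Real.sqrt m - (A * P * Real.sqrt m + a * Real.sqrt m) =
        a * Real.sqrt m * (P - 1) := by ring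
    linarith only [h0, e]
  -- (3) the tail is exactly `(8 C Z / π) √m`
  have hπy : (π * y)⁻¹ = (m : ℝ) * (N : ℝ) ^ 2 / π := by rw [hy_def]; field_simp
  have hπy0 : 0 ≤ (π * y)⁻¹ := by positivity
  have hπy1 : (π * y)⁻¹ + 1 ≤ 2 * ((m : ℝ) * (N : ℝ) ^ 2 / π) := by
    rw [hπy]
    have hπ4 : π < 4 := Real.pi_lt_four
    have h1 : (1 : ℝ) ≤ (m : ℝ) * (N : ℝ) ^ 2 / π := by
      rw [le_div_iff₀ Real.pi_pos]; linarith
    linarith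
  have hRpow : (((R + 1 : ℕ) : ℝ)) ^ (-(1 / 8 : ℝ)) =
      (m : ℝ) ^ (-(2 : ℝ)) * (N : ℝ) ^ (-(7 / 2 : ℝ)) := by
    rw [hR1r, Real.mul_rpow (by positivity) (by positivity)]
    rw [show ((m : ℝ) ^ 16) = (m : ℝ) ^ ((16 : ℕ) : ℝ) by rw [Real.rpow_natCast],
      show ((N : ℝ) ^ 28) = (N : ℝ) ^ ((28 : ℕ) : ℝ) by rw [Real.rpow_natCast],
      ← Real.rpow_mul hm0.le, ← Real.rpow_mul hN0.le]
    norm_num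
  have hNpow : (N : ℝ) ^ (-(1 / 2 : ℝ)) * ((N : ℝ) ^ 2) ^ 2 * (N : ℝ) ^ (-(7 / 2 : ℝ)) = 1 := by
    rw [show ((N : ℝ) ^ 2) ^ 2 = (N : ℝ) ^ ((4 : ℕ) : ℝ) by rw [Real.rpow_natCast]; ring,
      ← Real.rpow_add hN0, ← Real.rpow_add hN0]
    norm_num
  have hmpow : (m : ℝ) ^ 2 * (m : ℝ) ^ (-(2 : ℝ)) = 1 := by
    rw [show (m : ℝ) ^ 2 = (m : ℝ) ^ ((2 : ℕ) : ℝ) by rw [Real.rpow_natCast],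
      ← Real.rpow_add hm0]
    norm_num
  have htail : 4 * π * C * Real.sqrt m * (N : ℝ) ^ (-(1 / 2 : ℝ)) *
        ((π * y)⁻¹ * ((π * y)⁻¹ + 1)) * ((((R + 1 : ℕ) : ℝ)) ^ (-(1 / 8 : ℝ)) * Z) ≤
      8 * C * Z / π * Real.sqrt m := by
    have step : (π * y)⁻¹ * ((π * y)⁻¹ + 1) ≤
        ((m : ℝ) * (N : ℝ) ^ 2 / π) * (2 * ((m : ℝ) * (N : ℝ) ^ 2 / π)) := by
      rw [hπy] at hπy1 hπy0 ⊢
      exact mul_le_mul_of_nonneg_left hπy1 hπy0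
    have hfac0 : 0 ≤ 4 * π * C * Real.sqrt m * (N : ℝ) ^ (-(1 / 2 : ℝ)) := by positivity
    have hfac1 : 0 ≤ (((R + 1 : ℕ) : ℝ)) ^ (-(1 / 8 : ℝ)) * Z :=
      mul_nonneg (Real.rpow_nonneg (Nat.cast_nonneg _) _) hZ0
    calc 4 * π * C * Real.sqrt m * (N : ℝ) ^ (-(1 / 2 : ℝ)) * ((π * y)⁻¹ * ((π * y)⁻¹ + 1)) *
          ((((R + 1 : ℕ) : ℝ)) ^ (-(1 / 8 : ℝ)) * Z)
        ≤ 4 * π * C * Real.sqrt m * (N : ℝ) ^ (-(1 / 2 : ℝ)) *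
            (((m : ℝ) * (N : ℝ) ^ 2 / π) * (2 * ((m : ℝ) * (N : ℝ) ^ 2 / π))) *
            ((((R + 1 : ℕ) : ℝ)) ^ (-(1 / 8 : ℝ)) * Z) :=
          mul_le_mul_of_nonneg_right (mul_le_mul_of_nonneg_left step hfac0) hfac1
      _ = 8 * C * Z / π * Real.sqrt m *
            ((N : ℝ) ^ (-(1 / 2 : ℝ)) * ((N : ℝ) ^ 2) ^ 2 * (N : ℝ) ^ (-(7 / 2 : ℝ))) *
            ((m : ℝ) ^ 2 * (m : ℝ) ^ (-(2 : ℝ))) := by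
          rw [hRpow]; field_simp; ring
      _ = 8 * C * Z / π * Real.sqrt m := by rw [hNpow, hmpow]; ring
  rw [← ha] at htail
  have hlogpow : P ≤ (1 + 3 / ε) ^ 3 * (N : ℝ) ^ ε := by
    rw [hP, hL]; exact one_add_log_pow_three_le hN1 hε
  have hsqrt : Real.sqrt m = (m : ℝ) ^ (1 / 2 : ℝ) := Real.sqrt_eq_rpow m
  have hNε : (N : ℝ) ^ (-1 + ε) = (N : ℝ)⁻¹ * (N : ℝ) ^ ε := by
    rw [Real.rpow_add hN0, Real.rpow_neg_one]
  -- (5) the split bound, and assembly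
  have main := norm_tsum_weight_mul_petJ_le hN hm hy hC R
  rw [← hZ] at main
  refine main.trans ?_
  calc 2 * π / N * (2 * π * (3 + 2 * (-Real.log (1 - Real.exp (-(2 * π * y))))) *
          (1 + Real.log ((N : ℝ) * (R + 1))) * Real.sqrt m * (∑ r ∈ range (R + 1), (r : ℝ)⁻¹) +
        4 * π * C * Real.sqrt m * (N : ℝ) ^ (-(1 / 2 : ℝ)) * ((π * y)⁻¹ * ((π * y)⁻¹ + 1)) *
          ((((R + 1 : ℕ) : ℝ)) ^ (-(1 / 8 : ℝ)) * Z))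
      ≤ 2 * π / N * (K₀ * P * Real.sqrt m) :=
        mul_le_mul_of_nonneg_left ((add_le_add hhead htail).trans hsum) (by positivity)
    _ ≤ 2 * π / N * (K₀ * ((1 + 3 / ε) ^ 3 * (N : ℝ) ^ ε) * Real.sqrt m) := by
        gcongr
    _ = 2 * π * K₀ * (1 + 3 / ε) ^ 3 * (m : ℝ) ^ (1 / 2 : ℝ) * (N : ℝ) ^ (-1 + ε) := by
        rw [hsqrt, hNε, div_eq_mul_inv]; ring

end Literature.NumberTheory.LFunctions.Bettin2017

end
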